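import Literature.NumberTheory.LocalFields.VolkenbornIntegral
import HarnessLib

/-!
# Volkenborn bookkeeping for the `p`-adic zeta values: digit decomposition of the Riemann sums,
# strict differentiability of `t ↦ (a + bt)^m`, and `(1 − 2^{m−1}) B_m = ½ ∫_{ℤ_2} (1 + 4t)^m dt`

L. Lai, *On the irrationality of certain 2-adic zeta values*, Int. J. Number Theory 21 (2025) =
arXiv:2304.00816 [Lai2025TwoAdicZeta], §2.2–§2.3 (pp. 5–6), recalls (after Robert, *A Course in
p-adic Analysis*, GTM 198, Ch. V §5, and Cohen, *Number Theory* II) that "a function `f : ℤ_p → ℚ_p` is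
said to be Volkenborn integrable if the sequence `p^{−n} Σ_{k=0}^{p^n−1} f(k)` converges … every strictly
differentiable function on `ℤ_p` is Volkenborn integrable", that "the functions `L_p(·, ω^0), …,
L_p(·, ω^{p−2})` are exactly the `p − 1` branches interpolating the values of the Riemann zeta function
at negative integers", and states **Lemma 2.7**: "for any odd integer `j ≥ 3` we have
`ζ_2(j) = ½ ζ_2(j, ¼)`."

In the tree, `ζ_p(j)` (`PAdicZetaValues/Basic.lean`, `padicZetaValue`) IS the interpolation limit
`lim_N −(1 − p^{m_N − 1}) B_{m_N}/m_N`, while `ζ_p(j, x)` (`Hurwitz.lean`) is the Volkenborn form; so the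
discharge of Lemma 2.7 (sibling file `HurwitzLemma27TwoProofs.lean`) has to PROVE the interpolation for
the branch in question.  This file supplies the three Volkenborn ingredients, all derived from the
tree's `Literature/NumberTheory/LocalFields/VolkenbornIntegral.lean` (Robert V §5, REUSED):

* §1 `volkenbornSum_add_eq_sum_residues` — the digit decomposition of the Riemann sums
  `S_{r+e}(g) = p^{−e} Σ_{c < p^e} S_r(t ↦ g(c + p^e t))` (general `p`, any `g`).
* §2 `strictDiff_linear_pow` — the uniform strict-differentiability estimate (Robert's `S¹` form used
  by the tree's Volkenborn lemmas) for `t ↦ (a + bt)^m`, `|a|, |b| ≤ 1`, from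
  `‖(u + h)^m − u^m − m u^{m−1} h‖ ≤ ‖h‖²`.
* §3 `tendsto_volkenbornSum_one_add_four_mul_pow` — **for even `m ≥ 2`, in `ℚ_2`:
  `2^{−r} Σ_{n<2^r} (1 + 4n)^m → 2 (1 − 2^{m−1}) B_m`**, i.e. `(1 − 2^{m−1}) B_m = ½ ∫_{ℤ_2} (1+4t)^m dt`
  (the value `ζ_2(1 − m) = −(1 − 2^{m−1}) B_m/m` as an integral over `1 + 4ℤ_2`): from the digit
  decomposition modulo `4`, `4 S_{r+2}(t^m) − 2^{m+1} S_{r+1}(t^m) = S_r((4t+1)^m) + S_r((4t+3)^m)`, the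
  tree's `b_m = ∫ t^m dt` (`tendsto_volkenbornSum_pow`, Robert V.5.4) and the tree's reflection
  `σ : t ↦ −1 − t` (`tendsto_volkenbornSum_comp_sigma_sub`, Robert V.5.3), which swaps `(4t+1)^m` and
  `(4t+3)^m` for even `m`.

Theorems only; no statement file is touched.
Cell pub-zeta5 (HONEST FRAMING: systematic search; no irrationality claim unless kernel-certified):
`p`-adic bookkeeping for the RECORD vocabulary; nothing here bears on `ζ(5) ∈ ℝ`.
-/

noncomputable section

open Filter Finset
open scoped Topology

namespace Literature.NumberTheory.Irrationality.PAdicZetaValues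

open Literature.NumberTheory.LocalFields

variable {p : ℕ} [hp : Fact p.Prime]
variable {F : Type*} [NormedAddCommGroup F] [NormedSpace ℚ_[p] F]

/-! ## §1. Digit decomposition of the Riemann sums -/

/-- `Σ_{i < aN} h(i) = Σ_{n<N} Σ_{c<a} h(c + a n)` (write `i = c + a n`, `c < a`). [folklore] -/
private theorem sum_range_mul_eq_sum_sum {M : Type*} [AddCommMonoid M] (h : ℕ → M) (a N : ℕ) :
    ∑ i ∈ range (a * N), h i = ∑ n ∈ range N, ∑ c ∈ range a, h (c + a * n) := by
  induction N with
  | zero => simp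
  | succ N ih =>
    rw [Nat.mul_succ, Finset.sum_range_add, ih, Finset.sum_range_succ]
    simp only [add_comm]

/-- **Digit decomposition of the Riemann sums** ("`p^{−n} Σ_{k=0}^{p^n−1} f(k)`" split along the last
`e` digits of `k`): `S_{r+e}(g) = p^{−e} Σ_{c<p^e} S_r(t ↦ g(c + p^e t))`.
[cite: Lai2025TwoAdicZeta, §2.2 (definition of the Volkenborn integral, p. 5)] -/
theorem volkenbornSum_add_eq_sum_residues (g : ℤ_[p] → F) (r e : ℕ) :
    volkenbornSum p g (r + e) =
      ((p : ℚ_[p]) ^ e)⁻¹ • ∑ c ∈ range (p ^ e),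
        volkenbornSum p (fun t => g ((c : ℤ_[p]) + ((p ^ e : ℕ) : ℤ_[p]) * t)) r := by
  rw [volkenbornSum_def, show p ^ (r + e) = p ^ e * p ^ r by rw [pow_add, mul_comm],
    sum_range_mul_eq_sum_sum (fun i => g (i : ℤ_[p])) (p ^ e) (p ^ r), Finset.sum_comm]
  simp only [volkenbornSum_def]
  rw [← Finset.smul_sum, smul_smul]
  congr 1
  · rw [pow_add, mul_inv, mul_comm]
  · refine Finset.sum_congr rfl fun c _ => Finset.sum_congr rfl fun n _ => ?_
    push_cast
    ring_nf

/-! ## §2. Strict differentiability of `t ↦ (a + bt)^m` -/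

/-- `‖(u + h)^{n+1} − u^{n+1} − (n+1) uⁿ h‖ ≤ ‖h‖²` for `‖u‖, ‖h‖ ≤ 1` (the binomial remainder; by
induction `E_{n+2} = (u + h) E_{n+1} + (n+1) uⁿ h²`). [folklore] -/
private theorem norm_add_pow_sub_sub_le {u h : ℚ_[p]} (hu : ‖u‖ ≤ 1) (hh : ‖h‖ ≤ 1) (n : ℕ) :
    ‖(u + h) ^ (n + 1) - u ^ (n + 1) - ((n + 1 : ℕ) : ℚ_[p]) * u ^ n * h‖ ≤ ‖h‖ ^ 2 := by
  induction n with
  | zero => simp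
  | succ n ih =>
    have hid : (u + h) ^ (n + 1 + 1) - u ^ (n + 1 + 1) - ((n + 1 + 1 : ℕ) : ℚ_[p]) * u ^ (n + 1) * h =
        (u + h) * ((u + h) ^ (n + 1) - u ^ (n + 1) - ((n + 1 : ℕ) : ℚ_[p]) * u ^ n * h) +
          ((n + 1 : ℕ) : ℚ_[p]) * u ^ n * h ^ 2 := by
      push_cast
      ring
    rw [hid]
    have huh : ‖u + h‖ ≤ 1 := (IsUltrametricDist.norm_add_le_max _ _).trans (max_le hu hh)
    have hn1 : ‖((n + 1 : ℕ) : ℚ_[p])‖ ≤ 1 := by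
      have := Padic.norm_int_le_one (p := p) ((n + 1 : ℕ) : ℤ)
      rwa [Int.cast_natCast] at this
    refine (IsUltrametricDist.norm_add_le_max _ _).trans (max_le ?_ ?_)
    · rw [norm_mul]
      calc ‖u + h‖ * ‖(u + h) ^ (n + 1) - u ^ (n + 1) - ((n + 1 : ℕ) : ℚ_[p]) * u ^ n * h‖
          ≤ 1 * ‖h‖ ^ 2 := mul_le_mul huh ih (norm_nonneg _) zero_le_one
        _ = ‖h‖ ^ 2 := one_mul _
    · rw [norm_mul, norm_mul, norm_pow, norm_pow]
      calc ‖((n + 1 : ℕ) : ℚ_[p])‖ * ‖u‖ ^ n * ‖h‖ ^ 2 ≤ 1 * 1 * ‖h‖ ^ 2 := by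
            gcongr
            exact pow_le_one₀ (norm_nonneg _) hu
        _ = ‖h‖ ^ 2 := by ring

/-- `‖(u + h)^m − u^m − m u^{m−1} h‖ ≤ ‖h‖²` for `‖u‖, ‖h‖ ≤ 1`, all `m`. [folklore] -/
private theorem norm_add_pow_sub_sub_le' {u h : ℚ_[p]} (hu : ‖u‖ ≤ 1) (hh : ‖h‖ ≤ 1) (m : ℕ) :
    ‖(u + h) ^ m - u ^ m - (m : ℚ_[p]) * u ^ (m - 1) * h‖ ≤ ‖h‖ ^ 2 := by
  rcases Nat.eq_zero_or_pos m with rfl | hm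
  · simp
  · obtain ⟨n, rfl⟩ : ∃ n, m = n + 1 := ⟨m - 1, by omega⟩
    rw [Nat.add_sub_cancel]
    exact norm_add_pow_sub_sub_le hu hh n

/-- **`t ↦ (a + bt)^m` is strictly differentiable on `ℤ_p`** (`|a|, |b| ≤ 1`), in the uniform form used
by the tree's Volkenborn lemmas: for every `ε > 0` there is `δ > 0` with
`‖(a+by)^m − (a+bx)^m − (y − x)·m b (a+bx)^{m−1}‖ ≤ ε‖y − x‖` whenever `‖y − x‖ < δ` (indeed the left
side is `≤ ‖y − x‖²`; "every convergent power series on `ℤ_p` is strictly differentiable").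
[cite: Lai2025TwoAdicZeta, §2.2 (p. 5, strictly differentiable functions)] -/
theorem strictDiff_linear_pow {a b : ℚ_[p]} (ha : ‖a‖ ≤ 1) (hb : ‖b‖ ≤ 1) (m : ℕ) :
    ∀ ε > 0, ∃ δ > 0, ∀ x y : ℤ_[p], ‖y - x‖ < δ →
      ‖(a + b * (y : ℚ_[p])) ^ m - (a + b * (x : ℚ_[p])) ^ m -
          ((y - x : ℤ_[p]) : ℚ_[p]) • ((m : ℚ_[p]) * b * (a + b * (x : ℚ_[p])) ^ (m - 1))‖ ≤
        ε * ‖y - x‖ := by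
  intro ε hε
  refine ⟨ε, hε, fun x y hxy => ?_⟩
  have hx1 : ‖(x : ℚ_[p])‖ ≤ 1 := PadicInt.norm_le_one x
  have hu : ‖a + b * (x : ℚ_[p])‖ ≤ 1 := by
    refine (IsUltrametricDist.norm_add_le_max _ _).trans (max_le ha ?_)
    rw [norm_mul]
    exact mul_le_one₀ hb (norm_nonneg _) hx1
  have hyx : ‖((y - x : ℤ_[p]) : ℚ_[p])‖ = ‖y - x‖ := PadicInt.padic_norm_e_of_padicInt _
  have hh : ‖b * ((y - x : ℤ_[p]) : ℚ_[p])‖ ≤ ‖y - x‖ := by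
    rw [norm_mul, hyx]
    exact mul_le_of_le_one_left (norm_nonneg _) hb
  have hh1 : ‖b * ((y - x : ℤ_[p]) : ℚ_[p])‖ ≤ 1 := hh.trans (PadicInt.norm_le_one _)
  have key := norm_add_pow_sub_sub_le' hu hh1 m
  have hrew : (a + b * (y : ℚ_[p])) ^ m - (a + b * (x : ℚ_[p])) ^ m -
      ((y - x : ℤ_[p]) : ℚ_[p]) • ((m : ℚ_[p]) * b * (a + b * (x : ℚ_[p])) ^ (m - 1)) =
      (a + b * (x : ℚ_[p]) + b * ((y - x : ℤ_[p]) : ℚ_[p])) ^ m - (a + b * (x : ℚ_[p])) ^ m -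
        (m : ℚ_[p]) * (a + b * (x : ℚ_[p])) ^ (m - 1) * (b * ((y - x : ℤ_[p]) : ℚ_[p])) := by
    rw [smul_eq_mul]
    push_cast
    ring
  rw [hrew]
  refine key.trans ?_
  calc ‖b * ((y - x : ℤ_[p]) : ℚ_[p])‖ ^ 2 ≤ ‖y - x‖ ^ 2 := by
        gcongr
    _ = ‖y - x‖ * ‖y - x‖ := sq _
    _ ≤ ε * ‖y - x‖ := mul_le_mul_of_nonneg_right hxy.le (norm_nonneg _)

/-- The derivative `t ↦ m b (a + bt)^{m−1}` is continuous on `ℤ_p`.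
[cite: Lai2025TwoAdicZeta, §2.2 (p. 5, strictly differentiable functions)] -/
theorem continuous_linear_pow_deriv (a b : ℚ_[p]) (m : ℕ) :
    Continuous fun x : ℤ_[p] => (m : ℚ_[p]) * b * (a + b * (x : ℚ_[p])) ^ (m - 1) :=
  continuous_const.mul ((continuous_const.add (continuous_const.mul continuous_subtype_val)).pow _)

/-! ## §3. `(1 − 2^{m−1}) B_m = ½ ∫_{ℤ_2} (1 + 4t)^m dt` for even `m ≥ 2` -/

/-- **`2^{−r} Σ_{n<2^r} (1 + 4n)^m → 2(1 − 2^{m−1}) B_m` in `ℚ_2` for even `m ≥ 2`** — the value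
`−m ζ_2(1−m) = (1 − 2^{m−1}) B_m` ("the branches `L_p(·, ω^i)` interpolating the values of the Riemann zeta
function at negative integers", here `p = 2` over the residue class `1 + 4ℤ_2`) as ONE HALF of the
Volkenborn integral `∫_{ℤ_2} (1+4t)^m dt`: digit decomposition modulo `4`, `b_m = ∫ t^m dt`, and the
reflection `t ↦ −1−t` pairing `(4t+1)^m` with `(4t+3)^m`.
[cite: Lai2025TwoAdicZeta, §2.3 (p. 6, the interpolation property) and Lemma 2.7] -/
theorem tendsto_volkenbornSum_one_add_four_mul_pow {m : ℕ} (hm : Even m) (hm0 : m ≠ 0) :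
    Tendsto (volkenbornSum 2 (fun t : ℤ_[2] => ((1 : ℚ_[2]) + 4 * (t : ℚ_[2])) ^ m)) atTop
      (𝓝 (2 * (1 - (2 : ℚ_[2]) ^ (m - 1)) * ((bernoulli m : ℚ) : ℚ_[2]))) := by
  -- notation
  set f : ℤ_[2] → ℚ_[2] := fun t => ((1 : ℚ_[2]) + 4 * (t : ℚ_[2])) ^ m with hf
  set g : ℤ_[2] → ℚ_[2] := fun t => ((t : ℚ_[2])) ^ m with hg
  -- §3.1 the digit decompositions at depth 2 and 1
  have hdec2 : ∀ r, volkenbornSum 2 g (r + 2) =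
      ((2 : ℚ_[2]) ^ 2)⁻¹ * (volkenbornSum 2 (fun t => g (((0 : ℕ) : ℤ_[2]) + ((2 ^ 2 : ℕ) : ℤ_[2]) * t)) r +
        volkenbornSum 2 (fun t => g (((1 : ℕ) : ℤ_[2]) + ((2 ^ 2 : ℕ) : ℤ_[2]) * t)) r +
        volkenbornSum 2 (fun t => g (((2 : ℕ) : ℤ_[2]) + ((2 ^ 2 : ℕ) : ℤ_[2]) * t)) r +
        volkenbornSum 2 (fun t => g (((3 : ℕ) : ℤ_[2]) + ((2 ^ 2 : ℕ) : ℤ_[2]) * t)) r) := by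
    intro r
    have h := volkenbornSum_add_eq_sum_residues (p := 2) g r 2
    rw [h, smul_eq_mul]
    congr 1
    simp [Finset.sum_range_succ]
  have hdec1 : ∀ r, volkenbornSum 2 g (r + 1) =
      ((2 : ℚ_[2]) ^ 1)⁻¹ * (volkenbornSum 2 (fun t => g (((0 : ℕ) : ℤ_[2]) + ((2 ^ 1 : ℕ) : ℤ_[2]) * t)) r +
        volkenbornSum 2 (fun t => g (((1 : ℕ) : ℤ_[2]) + ((2 ^ 1 : ℕ) : ℤ_[2]) * t)) r) := by
    intro r
    have h := volkenbornSum_add_eq_sum_residues (p := 2) g r 1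
    rw [h, smul_eq_mul]
    congr 1
    simp [Finset.sum_range_succ]
  -- §3.2 the even residues: `(4t)^m = 2^m (2t)^m`, `(2+4t)^m = 2^m (1+2t)^m`
  have hA0 : (fun t : ℤ_[2] => g (((0 : ℕ) : ℤ_[2]) + ((2 ^ 2 : ℕ) : ℤ_[2]) * t)) =
      fun t => (2 : ℚ_[2]) ^ m • g (((0 : ℕ) : ℤ_[2]) + ((2 ^ 1 : ℕ) : ℤ_[2]) * t) := by
    funext t
    simp only [hg, smul_eq_mul, PadicInt.coe_add, PadicInt.coe_mul, PadicInt.coe_natCast]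
    push_cast
    rw [← mul_pow]
    congr 1
    ring
  have hA2 : (fun t : ℤ_[2] => g (((2 : ℕ) : ℤ_[2]) + ((2 ^ 2 : ℕ) : ℤ_[2]) * t)) =
      fun t => (2 : ℚ_[2]) ^ m • g (((1 : ℕ) : ℤ_[2]) + ((2 ^ 1 : ℕ) : ℤ_[2]) * t) := by
    funext t
    simp only [hg, smul_eq_mul, PadicInt.coe_add, PadicInt.coe_mul, PadicInt.coe_natCast]
    push_cast
    rw [← mul_pow]
    congr 1
    ring
  have heven : ∀ r, volkenbornSum 2 (fun t => g (((0 : ℕ) : ℤ_[2]) + ((2 ^ 2 : ℕ) : ℤ_[2]) * t)) r +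
      volkenbornSum 2 (fun t => g (((2 : ℕ) : ℤ_[2]) + ((2 ^ 2 : ℕ) : ℤ_[2]) * t)) r =
      (2 : ℚ_[2]) ^ (m + 1) * volkenbornSum 2 g (r + 1) := by
    intro r
    rw [hA0, hA2, volkenbornSum_smul, volkenbornSum_smul, hdec1 r]
    simp only [smul_eq_mul]
    ring
  -- §3.3 the odd residues: `c = 1` is `f`, `c = 3` is `f ∘ σ`
  have hone : (fun t : ℤ_[2] => g (((1 : ℕ) : ℤ_[2]) + ((2 ^ 2 : ℕ) : ℤ_[2]) * t)) = f := by
    funext t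
    simp only [hf, hg, PadicInt.coe_add, PadicInt.coe_mul, PadicInt.coe_natCast]
    push_cast
    ring
  have hthree : (fun t : ℤ_[2] => g (((3 : ℕ) : ℤ_[2]) + ((2 ^ 2 : ℕ) : ℤ_[2]) * t)) =
      fun t => f (-1 - t) := by
    funext t
    simp only [hf, hg, PadicInt.coe_add, PadicInt.coe_mul, PadicInt.coe_sub, PadicInt.coe_neg, PadicInt.coe_one,
      PadicInt.coe_natCast]
    push_cast
    conv_rhs => rw [← hm.neg_pow]
    congr 1
    ring
  -- §3.4 the identity `4 S_{r+2}(g) = 2^{m+1} S_{r+1}(g) + S_r(f) + S_r(f ∘ σ)`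
  have hident : ∀ r, volkenbornSum 2 f r =
      2⁻¹ * ((2 : ℚ_[2]) ^ 2 * volkenbornSum 2 g (r + 2) -
        (2 : ℚ_[2]) ^ (m + 1) * volkenbornSum 2 g (r + 1) -
        (volkenbornSum 2 (fun t => f (-1 - t)) r - volkenbornSum 2 f r)) := by
    intro r
    have h2 := hdec2 r
    rw [hone, hthree] at h2
    have h4 : (2 : ℚ_[2]) ^ 2 * volkenbornSum 2 g (r + 2) =
        volkenbornSum 2 (fun t => g (((0 : ℕ) : ℤ_[2]) + ((2 ^ 2 : ℕ) : ℤ_[2]) * t)) r +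
          volkenbornSum 2 f r +
          volkenbornSum 2 (fun t => g (((2 : ℕ) : ℤ_[2]) + ((2 ^ 2 : ℕ) : ℤ_[2]) * t)) r +
          volkenbornSum 2 (fun t => f (-1 - t)) r := by
      rw [h2, mul_inv_cancel_left₀ (pow_ne_zero 2 (two_ne_zero : (2 : ℚ_[2]) ≠ 0))]
    have h5 := heven r
    have e : (2 : ℚ_[2]) ^ 2 * volkenbornSum 2 g (r + 2) -
        (2 : ℚ_[2]) ^ (m + 1) * volkenbornSum 2 g (r + 1) =
        volkenbornSum 2 f r + volkenbornSum 2 (fun t => f (-1 - t)) r := by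
      rw [h4, ← h5]
      ring
    rw [e]
    ring
  -- §3.5 limits
  have hB : Tendsto (volkenbornSum 2 g) atTop (𝓝 ((bernoulli m : ℚ) : ℚ_[2])) :=
    tendsto_volkenbornSum_pow (p := 2) m
  have hB2 : Tendsto (fun r => volkenbornSum 2 g (r + 2)) atTop (𝓝 ((bernoulli m : ℚ) : ℚ_[2])) :=
    hB.comp (tendsto_add_atTop_nat 2)
  have hB1 : Tendsto (fun r => volkenbornSum 2 g (r + 1)) atTop (𝓝 ((bernoulli m : ℚ) : ℚ_[2])) :=
    hB.comp (tendsto_add_atTop_nat 1)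
  have h4norm : ‖(4 : ℚ_[2])‖ ≤ 1 := by
    have h := Padic.norm_int_le_one (p := 2) 4
    exact_mod_cast h
  have hσ : Tendsto (fun r => volkenbornSum 2 (fun t => f (-1 - t)) r - volkenbornSum 2 f r)
      atTop (𝓝 0) := by
    have hS := strictDiff_linear_pow (p := 2) (a := 1) (b := 4) (by simp) h4norm m
    have hc := continuous_linear_pow_deriv (p := 2) (1 : ℚ_[2]) 4 m
    exact tendsto_volkenbornSum_comp_sigma_sub (f := f) hc hS
  have hlim : Tendsto (fun r => 2⁻¹ * ((2 : ℚ_[2]) ^ 2 * volkenbornSum 2 g (r + 2) -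
      (2 : ℚ_[2]) ^ (m + 1) * volkenbornSum 2 g (r + 1) -
      (volkenbornSum 2 (fun t => f (-1 - t)) r - volkenbornSum 2 f r))) atTop
      (𝓝 (2⁻¹ * ((2 : ℚ_[2]) ^ 2 * ((bernoulli m : ℚ) : ℚ_[2]) -
        (2 : ℚ_[2]) ^ (m + 1) * ((bernoulli m : ℚ) : ℚ_[2]) - 0))) :=
    (((hB2.const_mul _).sub (hB1.const_mul _)).sub hσ).const_mul _
  have hval : 2⁻¹ * ((2 : ℚ_[2]) ^ 2 * ((bernoulli m : ℚ) : ℚ_[2]) -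
      (2 : ℚ_[2]) ^ (m + 1) * ((bernoulli m : ℚ) : ℚ_[2]) - 0) =
      2 * (1 - (2 : ℚ_[2]) ^ (m - 1)) * ((bernoulli m : ℚ) : ℚ_[2]) := by
    obtain ⟨n, rfl⟩ : ∃ n, m = n + 1 := ⟨m - 1, by omega⟩
    rw [Nat.add_sub_cancel, sub_zero]
    ring
  rw [hval] at hlim
  exact hlim.congr fun r => (hident r).symm

end Literature.NumberTheory.Irrationality.PAdicZetaValues
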